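import Literature.Probability.RandomMatrix.HaarUnitaryGramSchmidt
import Literature.Probability.RandomMatrix.GramSchmidtProjection
import Literature.Computability.QuantumComplexity.HaarUnitaryHiding
import HarnessLib

/-!
# Truncated Haar unitaries as truncated Gram–Schmidt columns of a Ginibre matrix

Let `𝒮_{m,n}` (`truncatedHaarMeasure m n`, file `HaarUnitaryHiding`) be the law of `√m` times the
top-left `n × n` block of a Haar-distributed `U ∈ U(m)` (Aaronson–Arkhipov 2013, §5.1). Using the
representation of Haar measure on `U(m)` as the law of the Gram–Schmidt unitary of a Ginibre matrix
(`haarProbability_eq_map_gsUnitary`, file `HaarUnitaryGramSchmidt`), this file expresses `𝒮_{m,n}`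
through only `n` Gaussian columns:

  `𝒮_{m,n} = Law(truncGS ω)`,  `ω ∼ ginibre m n` (`n` i.i.d. standard Gaussian vectors of `ℂ^m`),
  `truncGS ω i j = √m · conj((GSN ω)ᵢ(j))`   (`truncatedHaarMeasure_eq_map_truncGS`),

where `GSN = gramSchmidtNormed ℂ`. The two inputs are the inversion invariance of the Haar
probability measure of the compact group `U(m)` (the block of `U` has the law of the block of
`U⁻¹ = U*`, whose rows are conjugated Gram–Schmidt vectors — this is why the *rows* of `truncGS` are
frame vectors and why they are conjugated; with this orientation the Gram complement of the rows is
`1 − X*X/m`, the matrix whose eigenvalues are the squared singular values used by AA13) and the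
prefix property of Gram–Schmidt (`gramSchmidtNormed_comp_castLE`: the first `n` vectors only depend
on the first `n` columns).

Also recorded, for the column-by-column computation of the density of `𝒮_{m,n}`
(`GinibreColumnDensity`): the `snoc` recursion of the normalised Gram–Schmidt frame,
`GSN(ω, g) = (GSN ω, (g − ∑ⱼ ⟪GSN ω ⱼ, g⟫ GSN ω ⱼ)/‖…‖)` (`gramSchmidtNormed_snoc`, with the step
`gsStep` and the normalisation `unitize`), and the measurability of its ingredients.

## References

* S. Aaronson, A. Arkhipov, *The computational complexity of linear optics*, Theory of Computing 9
  (2013) 143–252, §5.1 (definition of `𝒮_{m,n}`).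
* F. Mezzadri, *How to generate random matrices from the classical compact groups*, Notices AMS 54
  (2007) 592–604, §4–5.
-/

open MeasureTheory Complex WithLp Real Set InnerProductSpace
open scoped ENNReal NNReal

namespace Literature.Probability.RandomMatrix

open Literature.Computability.QuantumComplexity (truncatedHaarMeasure scaledTruncation
  measurable_scaledTruncation scaledTruncation_apply)
open Literature.MathematicalPhysics.QuantumFieldTheory (haarProbability)
open Literature.Analysis.InnerProduct (gramSchmidt_comp_castSucc gramSchmidtNormed_comp_castSucc
  measurable_gramSchmidtNormed measurable_gramSchmidtNormed_apply)

/-! ### The Gram–Schmidt step and the `snoc` recursion -/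

/-- The projection onto the line of `v` in terms of the normalised vector `v/‖v‖`:
`(⟪v, g⟫/‖v‖²) v = ⟪v̂, g⟫ v̂`. [folklore] -/
theorem div_norm_sq_smul_eq {𝕜 F : Type*} [RCLike 𝕜] [NormedAddCommGroup F] [InnerProductSpace 𝕜 F]
    (v g : F) :
    (inner 𝕜 v g / ((‖v‖ ^ 2 : ℝ) : 𝕜)) • v =
      inner 𝕜 (((‖v‖ : 𝕜))⁻¹ • v) g • ((‖v‖ : 𝕜))⁻¹ • v := by
  rw [inner_smul_left, smul_smul]
  congr 1
  rw [map_inv₀, RCLike.conj_ofReal]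
  push_cast
  ring

section Generic

variable {E : Type*} [NormedAddCommGroup E] [InnerProductSpace ℂ E]

/-- One Gram–Schmidt step against an orthonormal frame `q`: the residual `g − ∑ⱼ ⟪qⱼ, g⟫ qⱼ`.
[folklore] -/
noncomputable def gsStep {k : ℕ} (q : Fin k → E) (g : E) : E := g - ∑ j, inner ℂ (q j) g • q j

/-- Normalisation `u ↦ u/‖u‖` (with `0 ↦ 0`). [folklore] -/
noncomputable def unitize (u : E) : E := (‖u‖⁻¹ : ℝ) • u

/-- **The `snoc` recursion of Gram–Schmidt, earlier vectors**: appending a vector does not change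
the first `k` normalised Gram–Schmidt vectors. [folklore] -/
theorem gramSchmidtNormed_snoc_castSucc {k : ℕ} (ω : Fin k → E) (g : E) (j : Fin k) :
    gramSchmidtNormed ℂ (Fin.snoc ω g : Fin (k + 1) → E) (Fin.castSucc j) = gramSchmidtNormed ℂ ω j := by
  rw [← gramSchmidtNormed_comp_castSucc, Fin.snoc_comp_castSucc]

/-- **The `snoc` recursion of Gram–Schmidt, last vector**: the last Gram–Schmidt vector of
`(ω, g)` is the residual of `g` against the normalised Gram–Schmidt frame of `ω`. [folklore] -/
theorem gramSchmidt_snoc_last {k : ℕ} (ω : Fin k → E) (g : E) :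
    gramSchmidt ℂ (Fin.snoc ω g : Fin (k + 1) → E) (Fin.last k) = gsStep (gramSchmidtNormed ℂ ω) g := by
  rw [gramSchmidt_def, Fin.snoc_last, Fin.Iio_last_eq_map, Finset.sum_map, gsStep]
  congr 1
  refine Finset.sum_congr rfl fun j _ => ?_
  change (ℂ ∙ gramSchmidt ℂ (Fin.snoc ω g : Fin (k + 1) → E) (Fin.castSucc j)).starProjection g = _
  rw [← gramSchmidt_comp_castSucc, Fin.snoc_comp_castSucc, Submodule.starProjection_singleton,
    gramSchmidtNormed, div_norm_sq_smul_eq]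

/-- The normalised last vector: `GSN(ω, g)_k = unitize (gsStep (GSN ω) g)`. [folklore] -/
theorem gramSchmidtNormed_snoc_last {k : ℕ} (ω : Fin k → E) (g : E) :
    gramSchmidtNormed ℂ (Fin.snoc ω g : Fin (k + 1) → E) (Fin.last k) =
      unitize (gsStep (gramSchmidtNormed ℂ ω) g) := by
  rw [gramSchmidtNormed, gramSchmidt_snoc_last, unitize, RCLike.real_smul_eq_coe_smul (K := ℂ),
    RCLike.ofReal_inv]

/-- **The `snoc` recursion of the normalised Gram–Schmidt frame.** [folklore] -/
theorem gramSchmidtNormed_snoc {k : ℕ} (ω : Fin k → E) (g : E) :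
    gramSchmidtNormed ℂ (Fin.snoc ω g : Fin (k + 1) → E) =
      Fin.snoc (gramSchmidtNormed ℂ ω) (unitize (gsStep (gramSchmidtNormed ℂ ω) g)) := by
  funext i
  induction i using Fin.lastCases with
  | last => rw [Fin.snoc_last, gramSchmidtNormed_snoc_last]
  | cast j => rw [Fin.snoc_castSucc, gramSchmidtNormed_snoc_castSucc]

/-! #### Measurability of the ingredients -/

/-- The Gram–Schmidt step is continuous in the pair (frame, vector). [folklore] -/
theorem continuous_gsStep (k : ℕ) :
    Continuous fun p : (Fin k → E) × E => gsStep p.1 p.2 := by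
  unfold gsStep
  refine continuous_snd.sub (continuous_finsetSum _ fun j _ => ?_)
  exact (((continuous_apply j).comp continuous_fst).inner continuous_snd).smul
    ((continuous_apply j).comp continuous_fst)

/-- `snoc` is measurable in the pair (frame, vector). [folklore] -/
theorem measurable_snoc {X : Type*} [MeasurableSpace X] (k : ℕ) :
    Measurable fun p : (Fin k → X) × X => (Fin.snoc p.1 p.2 : Fin (k + 1) → X) := by
  refine measurable_pi_lambda _ fun a => ?_
  induction a using Fin.lastCases with
  | last => simp only [Fin.snoc_last]; exact measurable_snd
  | cast j => simp only [Fin.snoc_castSucc]; exact (measurable_pi_apply j).comp measurable_fst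

variable [MeasurableSpace E] [BorelSpace E]

/-- Normalisation is measurable. [folklore] -/
theorem measurable_unitize : Measurable (unitize : E → E) :=
  (measurable_norm.inv).smul measurable_id

end Generic

/-! ### The Ginibre ensemble and truncated Haar unitaries -/

/-- `ℂ^m` as a Euclidean space. [folklore] -/
abbrev Euc (m : ℕ) := EuclideanSpace ℂ (Fin m)

/-- **The Ginibre ensemble, column form**: `k` independent standard complex Gaussian vectors of
`ℂ^m` (the columns of an `m × k` matrix of i.i.d. standard complex Gaussians). [folklore] -/
noncomputable def ginibre (m k : ℕ) : Measure (Fin k → Euc m) := Measure.pi fun _ => gaussianEuc (Fin m)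

/-- The Ginibre ensemble is a probability measure. [folklore] -/
instance ginibre.instIsProbabilityMeasure (m k : ℕ) : IsProbabilityMeasure (ginibre m k) := by
  unfold ginibre; infer_instance

/-- Gaussian columns are almost surely linearly independent (`k ≤ m`), the a.e. form of
`pi_gaussianEuc_not_linearIndependent`. [folklore] -/
theorem ae_linearIndependent_ginibre (m k : ℕ) (hk : k ≤ m) :
    ∀ᵐ ω ∂(ginibre m k), LinearIndependent ℂ ω := by
  rw [ae_iff]
  exact pi_gaussianEuc_not_linearIndependent k hk

variable (m n : ℕ) (h : n ≤ m)

/-- The scaled, conjugated `n × n` corner of the Gram–Schmidt frame of `n` columns of `ℂ^m`: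
`X i j = √m · conj((GSN ω)ᵢ(j))` (rows = conjugated truncated frame vectors). [folklore] -/
noncomputable def truncGS (ω : Fin n → Euc m) : Fin n → Fin n → ℂ :=
  fun i j => (Real.sqrt m : ℂ) * starRingEnd ℂ ((gramSchmidtNormed ℂ ω i) (Fin.castLE h j))

/-- `truncGS` is measurable. [folklore] -/
theorem measurable_truncGS : Measurable (truncGS m n h) :=
  measurable_pi_lambda _ fun i => measurable_pi_lambda _ fun j =>
    measurable_const.mul (Complex.continuous_conj.measurable.comp
      ((measurable_pi_apply (Fin.castLE h j)).comp ((measurable_ofLp_two (Fin m)).comp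
        (measurable_gramSchmidtNormed_apply ℂ i))))

/-- **The truncated Haar unitary as a function of `n` Gaussian columns.** The law `𝒮_{m,n}` of
`√m` times the top-left `n × n` block of a Haar unitary (`truncatedHaarMeasure`) is the law of
`truncGS` under `n` independent standard Gaussian vectors of `ℂ^m`. Proof: Haar measure on `U(m)` is
the law of the Gram–Schmidt unitary of a Ginibre matrix (`haarProbability_eq_map_gsUnitary`); by
inversion invariance of the Haar measure of the compact group `U(m)` the block of `U` has the law of
the block of `U⁻¹ = U*`, whose rows are the conjugated truncated Gram–Schmidt vectors; and the first
`n` of those only depend on the first `n` columns (`gramSchmidtNormed_comp_castLE`), which are again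
independent standard Gaussian vectors. (Aaronson–Arkhipov 2013, §5.1: `𝒮_{m,n}`, "the distribution
over `n × n` truncations of `m × m` Haar unitary matrices".) [folklore] -/
theorem truncatedHaarMeasure_eq_map_truncGS :
    truncatedHaarMeasure m n h = (ginibre m n).map (truncGS m n h) := by
  have hU : Measurable (gsUnitary (m := m)) := measurable_gsUnitary
  have hinv : Measurable (Inv.inv : Matrix.unitaryGroup (Fin m) ℂ → Matrix.unitaryGroup (Fin m) ℂ) :=
    measurable_inv
  have hres : Measurable fun (ω : Fin m → Euc m) (i : Fin n) => ω (Fin.castLE h i) :=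
    measurable_pi_lambda _ fun i => measurable_pi_apply _
  rw [truncatedHaarMeasure, ← Measure.map_inv_eq_self
    (haarProbability (Matrix.unitaryGroup (Fin m) ℂ)),
    Measure.map_map (measurable_scaledTruncation n h) hinv, haarProbability_eq_map_gsUnitary m]
  change ((ginibre m m).map gsUnitary).map (scaledTruncation n h ∘ Inv.inv) = _
  rw [Measure.map_map ((measurable_scaledTruncation n h).comp hinv) hU]
  have hae : (scaledTruncation n h ∘ Inv.inv) ∘ gsUnitary =ᵐ[ginibre m m]
      truncGS m n h ∘ fun ω i => ω (Fin.castLE h i) := by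
    filter_upwards [ae_linearIndependent_ginibre m m le_rfl] with ω hω
    simp only [Function.comp_apply]
    funext i j
    rw [scaledTruncation_apply, Matrix.UnitaryGroup.inv_apply, Matrix.star_apply,
      coe_gsUnitary_of_linearIndependent hω, truncGS]
    congr 1
    rw [gsMatrix, Complex.star_def, ← gramSchmidtNormed_comp_castLE h ω i]
    rfl
  rw [Measure.map_congr hae, ← Measure.map_map (measurable_truncGS m n h) hres, ginibre, ginibre,
    pi_map_comp_injective _ (Fin.castLE_injective h)]

end Literature.Probability.RandomMatrix
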